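import Mathlib
import Summits.Ventures.DiscreteObjects.Mahler.SmallMeasureCensus

/-!
# A kernel-checked lower bound for the Mahler measure of Lehmer's polynomial

Cell `pub-namedobj`, target (L). Framing: lottery ticket; floor = certified bounds/negative ranges.

We prove `117628 / 100000 < M(L)` for Lehmer's polynomial `L = x¹⁰+x⁹-x⁷-x⁶-x⁵-x⁴-x³+x+1`
(`Summit.Ventures.DiscreteObjects.Mahler.lehmerPoly`): `L(117628/100000) < 0 < L(117629/100000)`, so
by the intermediate value theorem `L` has a real root `α ∈ (1.17628, 1.17629)`; a root of a monic
polynomial is bounded by its Mahler measure (`M = ∏ max(1,|αᵢ|)`), hence `1.17628 < α ≤ M(L)`.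
(The cell's certified value is `M(L) = 1.1762808182599175065440703384740350506934158…`, three
independent engines; the matching upper bound needs the location of the other nine roots and is
not proved here.)
-/

namespace Summit.Ventures.DiscreteObjects.Mahler

open Polynomial

/-- Evaluation of Lehmer's polynomial in any commutative ring algebra. -/
theorem aeval_lehmerPoly {R : Type*} [CommRing R] [Algebra ℤ R] (x : R) :
    aeval x lehmerPoly = x ^ 10 + x ^ 9 - x ^ 7 - x ^ 6 - x ^ 5 - x ^ 4 - x ^ 3 + x + 1 := by
  simp [lehmerPoly, map_add, map_sub]

/-- A product of reals that are all `≥ 1` is `≥ 1`. -/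
theorem one_le_multiset_prod {t : Multiset ℝ} (h : ∀ y ∈ t, 1 ≤ y) : 1 ≤ t.prod := by
  induction t using Multiset.induction_on with
  | empty => simp
  | cons a u ih =>
    rw [Multiset.prod_cons]
    have ha : 1 ≤ a := h a (Multiset.mem_cons_self a u)
    have hu : 1 ≤ u.prod := ih (fun y hy => h y (Multiset.mem_cons_of_mem hy))
    nlinarith

/-- In a multiset of reals that are all `≥ 1`, every member is at most the product. -/
theorem le_prod_of_mem_of_one_le {s : Multiset ℝ} (h : ∀ y ∈ s, 1 ≤ y) {x : ℝ} (hx : x ∈ s) :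
    x ≤ s.prod := by
  obtain ⟨t, rfl⟩ := Multiset.exists_cons_of_mem hx
  rw [Multiset.prod_cons]
  have h1 : (1 : ℝ) ≤ t.prod := one_le_multiset_prod (fun y hy => h y (Multiset.mem_cons_of_mem hy))
  have hx1 : 0 ≤ x := le_trans zero_le_one (h x (Multiset.mem_cons_self x t))
  nlinarith

/-- The modulus of any complex root of a monic integer polynomial is at most its Mahler measure. -/
theorem norm_root_le_intMahlerMeasure {p : ℤ[X]} (hp : p.Monic) {z : ℂ}
    (hz : aeval z p = 0) : ‖z‖ ≤ intMahlerMeasure p := by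
  unfold intMahlerMeasure
  set q : ℂ[X] := p.map (Int.castRingHom ℂ) with hq
  have hqm : q.Monic := hp.map _
  have hq0 : q ≠ 0 := hqm.ne_zero
  rw [mahlerMeasure_eq_leadingCoeff_mul_prod_roots, hqm.leadingCoeff, norm_one, one_mul]
  have hzr : z ∈ q.roots := by
    rw [mem_roots hq0, IsRoot.def, hq, eval_map]
    rwa [aeval_def, algebraMap_int_eq] at hz
  have hmem : max 1 ‖z‖ ∈ q.roots.map (fun a => max 1 ‖a‖) := Multiset.mem_map_of_mem _ hzr
  have hall : ∀ y ∈ q.roots.map (fun a => max 1 ‖a‖), 1 ≤ y := by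
    intro y hy
    obtain ⟨a, _, rfl⟩ := Multiset.mem_map.mp hy
    exact le_max_left _ _
  exact le_trans (le_max_right 1 ‖z‖) (le_prod_of_mem_of_one_le hall hmem)

/-- Lehmer's polynomial is monic. -/
theorem lehmerPoly_monic : lehmerPoly.Monic := by
  unfold lehmerPoly
  monicity!

/-- **Lower bound for Lehmer's measure, kernel-checked:** `1.17628 < M(L)`. -/
theorem lehmer_measure_lower_bound : (117628 : ℝ) / 100000 < intMahlerMeasure lehmerPoly := by
  set f : ℝ → ℝ := fun x => x ^ 10 + x ^ 9 - x ^ 7 - x ^ 6 - x ^ 5 - x ^ 4 - x ^ 3 + x + 1 with hf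
  have hcont : Continuous f := by
    rw [hf]; fun_prop
  have ha : f (117628 / 100000) < 0 := by rw [hf]; norm_num
  have hb : 0 < f (117629 / 100000) := by rw [hf]; norm_num
  have hab : (117628 : ℝ) / 100000 ≤ 117629 / 100000 := by norm_num
  obtain ⟨α, hαI, hαf⟩ : ∃ α ∈ Set.Ioo ((117628 : ℝ) / 100000) (117629 / 100000), f α = 0 := by
    have hsub := intermediate_value_Ioo hab hcont.continuousOn
    exact hsub ⟨ha, hb⟩
  have hroot : aeval (α : ℂ) lehmerPoly = 0 := by
    rw [aeval_lehmerPoly]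
    have h0 : α ^ 10 + α ^ 9 - α ^ 7 - α ^ 6 - α ^ 5 - α ^ 4 - α ^ 3 + α + 1 = 0 := hαf
    exact_mod_cast congrArg (fun r : ℝ => (r : ℂ)) h0
  have hle : ‖(α : ℂ)‖ ≤ intMahlerMeasure lehmerPoly := norm_root_le_intMahlerMeasure lehmerPoly_monic hroot
  have hpos : 0 ≤ α := by linarith [hαI.1]
  rw [Complex.norm_real, Real.norm_of_nonneg hpos] at hle
  linarith [hαI.1]

end Summit.Ventures.DiscreteObjects.Mahler
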